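import Mathlib
import Summits.NavierStokesRegularity.FluidComputer.AbcInertiaCIRows
import Summits.NavierStokesRegularity.FluidComputer.AbcClassIEigenpairRow3001CClassical

/-!
# INERTIA-3L, CLASS I — «EXACTLY THE HOPF PAIR»: at `R = 300` the linearisation about the forced ABC flow has
# EXACTLY TWO classical class-I eigenvalues with `Re z ≥ 43/200`, the Hopf pair `λ⋆, conj λ⋆` of `Row3001C`
# (instab3 g9, cell `ns-blowup`, 2026-08-27)

HONEST FRAMING (human rulings D-0035/D-0074): **MODEL linear operator, computer-assisted; not NS.** Nothing
here is a statement about Navier–Stokes regularity or blow-up. Object: the linearisation of forced NS about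
`U = abcFlow 1 1 1` on the unit torus at viscosity `1/(2π·300)` (`R = 300` in certifier units), symmetry
CLASS I (trivial character; cert-3 g9's `AbcClassI` layer). bears_on LADDER-NS N1* T6 («contest-I at R 300:
the class-I Hopf pair vs the class-II steady leader») / profile W3. WHAT THIS IS NOT: not NS; no certificate
re-run; no number or census word moves.

This is the class-I twin of instab3 g8's `AbcInertiaExactlyOne.R300II_exactly_one` (INSTAB3-METHOD §14.9
addendum: «not ported: … a class-I ExactlyOne — needs a class-I coordinate export from cert-3's nested rows»;
that export is cert-3 g9's `AbcClassIEigenpair.row3001C_classI_eigenpairs_of_complex_bases`).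

* `exactly_pair_of_row_of_cell` (§1, generic): ANY cell conclusion «at most TWO distinct classical class-I
  eigenvalues with `Re ≥ a`» + ONE T2-row conclusion «`λ⋆` with `ℓ − ρ ≤ Re λ⋆`, `0 < Im λ⋆`, classical
  class-I eigenfunctions at `λ⋆` and `conj λ⋆`» + `a ≤ ℓ − ρ` ⇒ the pair is ALL of
  `σ_p(L|I) ∩ {Re ≥ a}` (classical eigenfunctions). Pure logic over `AbcInertiaCIRows.eq_pair_of_card_le_two`.
* `a_le_row3001C`: `43/200 ≤ Row3001C.lamRe − Row3001C.rho` (`norm_num` on the tree literals).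
* **`R300I_exactly_pair_i3`** / **`R300I_exactly_pair_i4`** (§2): the END-TO-END sentences with literal
  hypotheses — the T2 row `Row3001C` (implementation C = profile-cert-3, K₀ = 22, K_V = 96, in the certifier's
  COMPLEX orbit bases `wf`, AUDIT-BASIS-ℂ j275912 PASSED) and the INERTIA-3L class-I cell of implementation 1
  (`(r_L, r_H) = (26, 28)`, cert `cert_I3L_R300_cI_a43-200_rL26_rH28.json` d06cde2372d172d9, kit j269622) resp.
  implementation 2 (`(28, 29)`, `inertia_cert_R300_cI_rL28_rH29.json`, kit j269943), (R1)(R2) stated on the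
  kernel's class-I coordinates `AbcClassI.amat` exactly as in `AbcInertiaCIRows` ⇒
  `σ_p(L_300|I) ∩ {Re ≥ 43/200} = {λ⋆, conj λ⋆}`, `|λ⋆ − (0.2641917… + 0.6430289… i)| ≤ 7.5·10⁻¹²`.
  What is NOT kernel: the row's primary interval outputs and (R1)(R2) = the programs' verified arithmetic
  (referee re-runs), AUDIT-BASIS (class-I INERTIA hypotheses are over the tree's orbit bases `AbcClassI.bfam`;
  the real-orthonormal basis transfer for class I — the twin of `AbcInertiaBases` — is not in the tree yet).

Mathlib + the two files named; no new definitions; std axioms. [folklore]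
-/

noncomputable section

open scoped BigOperators ComplexConjugate InnerProductSpace Matrix
open Finset Matrix MeasureTheory UnitAddTorus

namespace Summit.NavierStokesRegularity.FluidComputer.AbcInertiaCI

open Literature.Analysis.FunctionSpaces Literature.Analysis.FunctionSpaces.Torus
open Literature.Analysis.FluidPDE
open Summit.NavierStokesRegularity.FluidComputer.AbcClassI
open Summit.NavierStokesRegularity.FluidComputer.AbcClassII (Fam crossForm Orbit onormSq)
open Summit.NavierStokesRegularity.FluidComputer.CertificateAbcSpectrum

/-! ### §1 The generic composition and the abscissa check -/

/-- **Row + cell ⇒ exactly the pair.** From any INERTIA-3L class-I cell conclusion `hcell` («at most TWO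
pairwise-distinct classical class-I eigenvalues with `Re ≥ a`»), a T2-row conclusion (an eigenvalue `λ⋆` within
`ρ` of `λ̃`, `ℓ − ρ ≤ Re λ⋆`, `0 < Im λ⋆`, classical class-I eigenfunctions at `λ⋆` and at `conj λ⋆`) and
`a ≤ ℓ − ρ`: the same `λ⋆` data, and every classical class-I eigenpair `(z, u)` with `Re z ≥ a` has
`z = λ⋆ ∨ z = conj λ⋆`. -/
theorem exactly_pair_of_row_of_cell {ν a ℓ ρ : ℝ} {lt : ℂ} (ha : a ≤ ℓ - ρ)
    (hcell : ∀ {n : ℕ} (z : Fin n → ℂ), Function.Injective z →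
      ∀ (u : Fin n → UnitAddTorus (Fin 3) → EuclideanSpace ℂ (Fin 3)),
      (∀ k, Torus.LinNSResolventRel ν (Torus.abcFlow 1 1 1) (2 * Real.pi * z k) (u k) 0) →
      (∀ k, u k ≠ 0) → (∀ k, IsClassI (mFourierCoeff (u k))) → (∀ k, a ≤ (z k).re) → n ≤ 2)
    (lam : ℂ) (hclose : ‖lam - lt‖ ≤ ρ) (hrelo : ℓ - ρ ≤ lam.re) (him : 0 < lam.im)
    (hpair : ∃ u : UnitAddTorus (Fin 3) → EuclideanSpace ℂ (Fin 3),
      Torus.LinNSResolventRel ν (Torus.abcFlow 1 1 1) (2 * Real.pi * lam) u 0 ∧ u ≠ 0 ∧ IsClassI (mFourierCoeff u))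
    (hpairc : ∃ u : UnitAddTorus (Fin 3) → EuclideanSpace ℂ (Fin 3),
      Torus.LinNSResolventRel ν (Torus.abcFlow 1 1 1) (2 * Real.pi * conj lam) u 0 ∧ u ≠ 0 ∧
        IsClassI (mFourierCoeff u)) :
    ∃ lam : ℂ, ‖lam - lt‖ ≤ ρ ∧ ℓ - ρ ≤ lam.re ∧ 0 < lam.im ∧
      (∃ u : UnitAddTorus (Fin 3) → EuclideanSpace ℂ (Fin 3),
        Torus.LinNSResolventRel ν (Torus.abcFlow 1 1 1) (2 * Real.pi * lam) u 0 ∧ u ≠ 0 ∧ IsClassI (mFourierCoeff u)) ∧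
      (∃ u : UnitAddTorus (Fin 3) → EuclideanSpace ℂ (Fin 3),
        Torus.LinNSResolventRel ν (Torus.abcFlow 1 1 1) (2 * Real.pi * conj lam) u 0 ∧ u ≠ 0 ∧
          IsClassI (mFourierCoeff u)) ∧
      ∀ (z : ℂ) (u : UnitAddTorus (Fin 3) → EuclideanSpace ℂ (Fin 3)),
        Torus.LinNSResolventRel ν (Torus.abcFlow 1 1 1) (2 * Real.pi * z) u 0 → u ≠ 0 →
          IsClassI (mFourierCoeff u) → a ≤ z.re → z = lam ∨ z = conj lam := by
  obtain ⟨ulam, hulam, hulam0, hulamI⟩ := hpair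
  obtain ⟨ubar, hubar, hubar0, hubarI⟩ := hpairc
  have hne : conj lam ≠ lam := by
    intro h
    have h2 : (conj lam).im = lam.im := by rw [h]
    rw [Complex.conj_im] at h2
    linarith
  have hlamre : a ≤ lam.re := ha.trans hrelo
  refine ⟨lam, hclose, hrelo, him, ⟨ulam, hulam, hulam0, hulamI⟩, ⟨ubar, hubar, hubar0, hubarI⟩,
    fun z u hu hu0 huI hzre => ?_⟩
  exact eq_pair_of_card_le_two (ν := ν) (a := a) (fun z hz u hu hu0 hI hre => hcell z hz u hu hu0 hI hre)
    lam ulam ubar hulam hulam0 hulamI hubar hubar0 hubarI hne hlamre z u hu hu0 huI hzre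

/-- The class-I abscissa of record lies left of the `Row3001C` enclosure: `43/200 ≤ Row3001C.lamRe − Row3001C.rho`
(`0.215 ≤ 0.26419… − 7.5·10⁻¹²`). -/
theorem a_le_row3001C : (43 / 200 : ℝ) ≤ ((Row3001C.lamRe : ℚ) : ℝ) - ((Row3001C.rho : ℚ) : ℝ) := by
  have h : (43 / 200 : ℚ) ≤ Row3001C.lamRe - Row3001C.rho := by norm_num [Row3001C.lamRe, Row3001C.rho]
  have h' : ((43 / 200 : ℚ) : ℝ) ≤ ((Row3001C.lamRe - Row3001C.rho : ℚ) : ℝ) := by exact_mod_cast h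
  push_cast at h'
  linarith

/-! ### §2 The END-TO-END sentences (R 300, class I) -/

section Row

variable (wf : AbcClassI.Idx → Fam)
variable (hws : ∀ i : AbcClassI.Idx, ∀ k ∉ i.1.1, wf i k = 0)
variable (hwt : ∀ (i : AbcClassI.Idx) (k : Fin 3 → ℤ), ∑ j : Fin 3, ((k j : ℤ) : ℂ) * wf i k j = 0)
variable (hwI : ∀ i : AbcClassI.Idx, IsClassI (wf i))
variable (hwon : ∀ (O : Orbit) (a b : Fin (AbcClassI.odim O)),
  ∑ k ∈ O.1, (inner ℂ (wf ⟨O, a⟩ k) (wf ⟨O, b⟩ k) : ℂ) = if a = b then 1 else 0)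
variable (amc : AbcClassI.Idx → AbcClassI.Idx → ℂ)
variable (hamc : ∀ i j : AbcClassI.Idx, amc i j =
  ∑ k ∈ i.1.1, (inner ℂ (wf i k) (Torus.lerayCoeff k (crossForm 1 1 1 (wf j) k)) : ℂ))

include hws hwt hwI hwon hamc in
/-- **R = 300, CLASS I: EXACTLY THE HOPF PAIR — IMPLEMENTATION 1's INERTIA cell.** The T2 row `Row3001C` (implementation C, in the
complex orbit bases `wf`; hypotheses VERBATIM those of `AbcClassIEigenpair.row3001C_classI_eigenpairs_of_complex_bases`)
AND the INERTIA-3L class-I cell `(300, I, 43/200, 2; 26, 28)` ((R1)(R2) on the kernel's class-I coordinates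
`AbcClassI.amat`, VERBATIM those of `AbcInertiaCIRows.R300I_rL26_rH28_card_le_two`) IMPLY: there is `λ⋆` with
`|λ⋆ − λ̃| ≤ Row3001C.rho`, `Row3001C.lamRe − Row3001C.rho ≤ Re λ⋆`, `Im λ⋆ > 0`, classical CLASS-I eigenfunctions at
`λ⋆` and at `conj λ⋆`, and EVERY classical class-I eigenpair `(z, u)` with `Re z ≥ 43/200` has `z = λ⋆ ∨ z = conj λ⋆`.
MODEL; conditional on the two certifier audits and AUDIT-BASIS. -/
theorem R300I_exactly_pair_i3
    (vt : AbcClassI.Idx → ℂ) (hvt0 : ∀ i, i ∉ AbcClassI.cubeIdx 96 → vt i = 0)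
    (hres : ∑ i ∈ AbcClassI.cubeIdx 96 ∪ (AbcClassI.cubeIdx 96).biUnion AbcClassI.nbrIdx,
      ‖(if i ∈ AbcClassI.cubeIdx 96 then (((((Row3001C.lamRe : ℚ) : ℝ) : ℂ) + (((Row3001C.lamIm : ℚ) : ℝ) : ℂ) * Complex.I) - ((-(onormSq i.1 / 300) : ℝ) : ℂ)) * vt i
          else 0) - ∑ j ∈ AbcClassI.cubeIdx 96, amc i j * vt j‖ ^ 2 ≤ ((Row3001C.rnorm : ℚ) : ℝ) ^ 2)
    (hntb : ∑ i ∈ AbcClassI.cubeIdx 96 \ AbcClassI.cubeIdx 22, ‖vt i‖ ^ 2 ≤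
      (((2315674124931519 : ℚ) / 288230376151711744 : ℚ) : ℝ) ^ 2)
    (Binv : ((↥(AbcClassI.cubeIdx 22) → ℂ) × ℂ) →ₗ[ℂ] ((↥(AbcClassI.cubeIdx 22) → ℂ) × ℂ))
    (hBinv : ∀ (c : ↥(AbcClassI.cubeIdx 22) → ℂ) (m : ℂ),
      Binv (fun i : ↥(AbcClassI.cubeIdx 22) =>
          (((((Row3001C.lamRe : ℚ) : ℝ) : ℂ) + (((Row3001C.lamIm : ℚ) : ℝ) : ℂ) * Complex.I) - ((-(onormSq i.1.1 / 300) : ℝ) : ℂ)) * c i -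
          ∑ j : ↥(AbcClassI.cubeIdx 22), amc i j * c j + m * vt i,
        ∑ i : ↥(AbcClassI.cubeIdx 22), conj (vt i) * c i) = (c, m))
    (hαM : ∀ (c : ↥(AbcClassI.cubeIdx 22) → ℂ) (g : ℂ),
      ∑ j : ↥(AbcClassI.cubeIdx 22), ‖(Binv (c, g)).1 j‖ ^ 2 + ‖(Binv (c, g)).2‖ ^ 2 ≤
        ((Row3001C.alpha0 : ℚ) : ℝ) ^ 2 * (∑ i : ↥(AbcClassI.cubeIdx 22), ‖c i‖ ^ 2 + ‖g‖ ^ 2))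
    (hβBM : ∀ w : AbcClassI.Idx → ℂ,
      ∑ j : ↥(AbcClassI.cubeIdx 22), ‖(Binv (fun i : ↥(AbcClassI.cubeIdx 22) => -∑ j ∈ AbcClassI.nbrIdx i \ AbcClassI.cubeIdx 22,
          amc i j * w j, 0)).1 j‖ ^ 2 +
        ‖(Binv (fun i : ↥(AbcClassI.cubeIdx 22) => -∑ j ∈ AbcClassI.nbrIdx i \ AbcClassI.cubeIdx 22,
          amc i j * w j, 0)).2‖ ^ 2 ≤
        ((Row3001C.betaB : ℚ) : ℝ) ^ 2 * ∑ j ∈ (AbcClassI.cubeIdx 22).biUnion AbcClassI.nbrIdx \ AbcClassI.cubeIdx 22, ‖w j‖ ^ 2)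
    (hβCM : ∀ (c : ↥(AbcClassI.cubeIdx 22) → ℂ) (g : ℂ),
      ∑ i ∈ ((AbcClassI.cubeIdx 22).biUnion AbcClassI.nbrIdx ∪ AbcClassI.cubeIdx 96) \ AbcClassI.cubeIdx 22,
        ‖-∑ j : ↥(AbcClassI.cubeIdx 22), amc i j * (Binv (c, g)).1 j +
          (Binv (c, g)).2 * vt i‖ ^ 2 ≤
        ((Row3001C.betaC : ℚ) : ℝ) ^ 2 * (∑ i : ↥(AbcClassI.cubeIdx 22), ‖c i‖ ^ 2 + ‖g‖ ^ 2))
    (hgBM : ∀ w : AbcClassI.Idx → ℂ,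
      ‖(Binv (fun i : ↥(AbcClassI.cubeIdx 22) => ∑ j ∈ AbcClassI.nbrIdx i \ AbcClassI.cubeIdx 22,
          amc i j * w j, 0)).2‖ ^ 2 ≤
        (((2617195581838679 : ℚ) / 2251799813685248 : ℚ) : ℝ) ^ 2 *
          ∑ j ∈ (AbcClassI.cubeIdx 22).biUnion AbcClassI.nbrIdx \ AbcClassI.cubeIdx 22, ‖w j‖ ^ 2)
    (hshellM : ∀ w : AbcClassI.Idx → ℂ, (∀ i ∈ AbcClassI.cubeIdx 22, w i = 0) →
      (((5524214073445137 : ℚ) / 9007199254740992 : ℚ) : ℝ) * ∑ i ∈ AbcClassI.cubeIdx (22 + 1) \ AbcClassI.cubeIdx 22, ‖w i‖ ^ 2 ≤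
        ∑ i ∈ AbcClassI.cubeIdx (22 + 1) \ AbcClassI.cubeIdx 22,
          (((((Row3001C.lamRe : ℚ) : ℝ) : ℂ) + (((Row3001C.lamIm : ℚ) : ℝ) : ℂ) * Complex.I).re - (-(onormSq i.1 / 300)) - Real.sqrt 2) * ‖w i‖ ^ 2 -
        RCLike.re (∑ i ∈ (AbcClassI.cubeIdx 22).biUnion AbcClassI.nbrIdx \ AbcClassI.cubeIdx 22,
          conj (∑ j : ↥(AbcClassI.cubeIdx 22), amc i j *
            (Binv (fun i : ↥(AbcClassI.cubeIdx 22) => ∑ j ∈ AbcClassI.nbrIdx i \ AbcClassI.cubeIdx 22,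
              amc i j * w j, 0)).1 j) * w i))
    {HL HH HB : Finset AbcClassI.Idx}
    (hHL : ∀ i : AbcClassI.Idx, i ∈ HL ↔ onormSq i.1 ≤ (26 : ℝ) ^ 2)
    (hHH : ∀ i : AbcClassI.Idx, i ∈ HH ↔ onormSq i.1 ≤ (28 : ℝ) ^ 2)
    (hHB : ∀ i : AbcClassI.Idx, i ∈ HB ↔ (28 : ℝ) ^ 2 < onormSq i.1 ∧ onormSq i.1 ≤ ((28 : ℝ) + 1) ^ 2)
    (GH Ah : Matrix ↥HH ↥HH ℝ) (AHB : Matrix ↥HH ↥HB ℝ) (ABH : Matrix ↥HB ↥HH ℝ) (E : ↥HB → ℝ)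
    (V : Matrix ↥HH (Fin 2) ℝ) (hGH : GHᵀ = GH)
    (hAh : Ah = Matrix.of fun i j : ↥HH =>
      (if i = j then -(onormSq i.1.1 / (300 : ℝ)) - (43 / 200 : ℝ) else 0) + AbcClassI.amat i.1 j.1)
    (hAHB : AHB = Matrix.of fun (i : ↥HH) (l : ↥HB) => AbcClassI.amat i.1 l.1)
    (hABH : ABH = Matrix.of fun (l : ↥HB) (i : ↥HH) => AbcClassI.amat l.1 i.1)
    (hE : E = fun l : ↥HB => onormSq l.1.1 / (300 : ℝ) + (43 / 200 : ℝ) - Real.sqrt 2)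
    (hR1 : ∀ x : ↥HH → ℝ, x ≠ 0 →
      x ⬝ᵥ ((GH * Ah + Ahᵀ * GH + (1 / 2 : ℝ) • ((GH * AHB + ABHᵀ) * Matrix.diagonal (fun l => (E l)⁻¹) *
        (GH * AHB + ABHᵀ)ᵀ)) *ᵥ x) < 0)
    (hR2 : ∀ x : ↥HH → ℝ, 0 ≤ x ⬝ᵥ ((GH + V * Vᵀ) *ᵥ x)) :
    ∃ lam : ℂ, ‖lam - ((((Row3001C.lamRe : ℚ) : ℝ) : ℂ) + (((Row3001C.lamIm : ℚ) : ℝ) : ℂ) * Complex.I)‖ ≤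
        ((Row3001C.rho : ℚ) : ℝ) ∧ ((Row3001C.lamRe : ℚ) : ℝ) - ((Row3001C.rho : ℚ) : ℝ) ≤ lam.re ∧ 0 < lam.im ∧
      (∃ u : UnitAddTorus (Fin 3) → EuclideanSpace ℂ (Fin 3),
        Torus.LinNSResolventRel (1 / (2 * Real.pi * 300)) (Torus.abcFlow 1 1 1) (2 * Real.pi * lam) u 0 ∧
          u ≠ 0 ∧ IsClassI (mFourierCoeff u)) ∧
      (∃ u : UnitAddTorus (Fin 3) → EuclideanSpace ℂ (Fin 3),
        Torus.LinNSResolventRel (1 / (2 * Real.pi * 300)) (Torus.abcFlow 1 1 1) (2 * Real.pi * conj lam) u 0 ∧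
          u ≠ 0 ∧ IsClassI (mFourierCoeff u)) ∧
      ∀ (z : ℂ) (u : UnitAddTorus (Fin 3) → EuclideanSpace ℂ (Fin 3)),
        Torus.LinNSResolventRel (1 / (2 * Real.pi * 300)) (Torus.abcFlow 1 1 1) (2 * Real.pi * z) u 0 → u ≠ 0 →
          IsClassI (mFourierCoeff u) → (43 / 200 : ℝ) ≤ z.re → z = lam ∨ z = conj lam := by
  obtain ⟨lam, hclose, hrelo, -, him, hpair, hpairc, -, -⟩ :=
    AbcClassIEigenpair.row3001C_classI_eigenpairs_of_complex_bases wf hws hwt hwI hwon amc hamc vt hvt0 hres hntb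
      Binv hBinv hαM hβBM hβCM hgBM hshellM
  exact exactly_pair_of_row_of_cell (a := 43 / 200) a_le_row3001C
    (fun z hz u hu hu0 hI hre => R300I_rL26_rH28_card_le_two hHL hHH hHB GH Ah AHB ABH E V hGH hAh hAHB hABH hE hR1 hR2
      z hz u hu hu0 hI hre)
    lam hclose hrelo him hpair hpairc

include hws hwt hwI hwon hamc in
/-- **R = 300, CLASS I: EXACTLY THE HOPF PAIR — IMPLEMENTATION 2's INERTIA cell.** The T2 row `Row3001C` (implementation C, in the
complex orbit bases `wf`; hypotheses VERBATIM those of `AbcClassIEigenpair.row3001C_classI_eigenpairs_of_complex_bases`)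
AND the INERTIA-3L class-I cell `(300, I, 43/200, 2; 28, 29)` ((R1)(R2) on the kernel's class-I coordinates
`AbcClassI.amat`, VERBATIM those of `AbcInertiaCIRows.R300I_rL28_rH29_card_le_two`) IMPLY: there is `λ⋆` with
`|λ⋆ − λ̃| ≤ Row3001C.rho`, `Row3001C.lamRe − Row3001C.rho ≤ Re λ⋆`, `Im λ⋆ > 0`, classical CLASS-I eigenfunctions at
`λ⋆` and at `conj λ⋆`, and EVERY classical class-I eigenpair `(z, u)` with `Re z ≥ 43/200` has `z = λ⋆ ∨ z = conj λ⋆`.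
MODEL; conditional on the two certifier audits and AUDIT-BASIS. -/
theorem R300I_exactly_pair_i4
    (vt : AbcClassI.Idx → ℂ) (hvt0 : ∀ i, i ∉ AbcClassI.cubeIdx 96 → vt i = 0)
    (hres : ∑ i ∈ AbcClassI.cubeIdx 96 ∪ (AbcClassI.cubeIdx 96).biUnion AbcClassI.nbrIdx,
      ‖(if i ∈ AbcClassI.cubeIdx 96 then (((((Row3001C.lamRe : ℚ) : ℝ) : ℂ) + (((Row3001C.lamIm : ℚ) : ℝ) : ℂ) * Complex.I) - ((-(onormSq i.1 / 300) : ℝ) : ℂ)) * vt i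
          else 0) - ∑ j ∈ AbcClassI.cubeIdx 96, amc i j * vt j‖ ^ 2 ≤ ((Row3001C.rnorm : ℚ) : ℝ) ^ 2)
    (hntb : ∑ i ∈ AbcClassI.cubeIdx 96 \ AbcClassI.cubeIdx 22, ‖vt i‖ ^ 2 ≤
      (((2315674124931519 : ℚ) / 288230376151711744 : ℚ) : ℝ) ^ 2)
    (Binv : ((↥(AbcClassI.cubeIdx 22) → ℂ) × ℂ) →ₗ[ℂ] ((↥(AbcClassI.cubeIdx 22) → ℂ) × ℂ))
    (hBinv : ∀ (c : ↥(AbcClassI.cubeIdx 22) → ℂ) (m : ℂ),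
      Binv (fun i : ↥(AbcClassI.cubeIdx 22) =>
          (((((Row3001C.lamRe : ℚ) : ℝ) : ℂ) + (((Row3001C.lamIm : ℚ) : ℝ) : ℂ) * Complex.I) - ((-(onormSq i.1.1 / 300) : ℝ) : ℂ)) * c i -
          ∑ j : ↥(AbcClassI.cubeIdx 22), amc i j * c j + m * vt i,
        ∑ i : ↥(AbcClassI.cubeIdx 22), conj (vt i) * c i) = (c, m))
    (hαM : ∀ (c : ↥(AbcClassI.cubeIdx 22) → ℂ) (g : ℂ),
      ∑ j : ↥(AbcClassI.cubeIdx 22), ‖(Binv (c, g)).1 j‖ ^ 2 + ‖(Binv (c, g)).2‖ ^ 2 ≤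
        ((Row3001C.alpha0 : ℚ) : ℝ) ^ 2 * (∑ i : ↥(AbcClassI.cubeIdx 22), ‖c i‖ ^ 2 + ‖g‖ ^ 2))
    (hβBM : ∀ w : AbcClassI.Idx → ℂ,
      ∑ j : ↥(AbcClassI.cubeIdx 22), ‖(Binv (fun i : ↥(AbcClassI.cubeIdx 22) => -∑ j ∈ AbcClassI.nbrIdx i \ AbcClassI.cubeIdx 22,
          amc i j * w j, 0)).1 j‖ ^ 2 +
        ‖(Binv (fun i : ↥(AbcClassI.cubeIdx 22) => -∑ j ∈ AbcClassI.nbrIdx i \ AbcClassI.cubeIdx 22,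
          amc i j * w j, 0)).2‖ ^ 2 ≤
        ((Row3001C.betaB : ℚ) : ℝ) ^ 2 * ∑ j ∈ (AbcClassI.cubeIdx 22).biUnion AbcClassI.nbrIdx \ AbcClassI.cubeIdx 22, ‖w j‖ ^ 2)
    (hβCM : ∀ (c : ↥(AbcClassI.cubeIdx 22) → ℂ) (g : ℂ),
      ∑ i ∈ ((AbcClassI.cubeIdx 22).biUnion AbcClassI.nbrIdx ∪ AbcClassI.cubeIdx 96) \ AbcClassI.cubeIdx 22,
        ‖-∑ j : ↥(AbcClassI.cubeIdx 22), amc i j * (Binv (c, g)).1 j +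
          (Binv (c, g)).2 * vt i‖ ^ 2 ≤
        ((Row3001C.betaC : ℚ) : ℝ) ^ 2 * (∑ i : ↥(AbcClassI.cubeIdx 22), ‖c i‖ ^ 2 + ‖g‖ ^ 2))
    (hgBM : ∀ w : AbcClassI.Idx → ℂ,
      ‖(Binv (fun i : ↥(AbcClassI.cubeIdx 22) => ∑ j ∈ AbcClassI.nbrIdx i \ AbcClassI.cubeIdx 22,
          amc i j * w j, 0)).2‖ ^ 2 ≤
        (((2617195581838679 : ℚ) / 2251799813685248 : ℚ) : ℝ) ^ 2 *
          ∑ j ∈ (AbcClassI.cubeIdx 22).biUnion AbcClassI.nbrIdx \ AbcClassI.cubeIdx 22, ‖w j‖ ^ 2)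
    (hshellM : ∀ w : AbcClassI.Idx → ℂ, (∀ i ∈ AbcClassI.cubeIdx 22, w i = 0) →
      (((5524214073445137 : ℚ) / 9007199254740992 : ℚ) : ℝ) * ∑ i ∈ AbcClassI.cubeIdx (22 + 1) \ AbcClassI.cubeIdx 22, ‖w i‖ ^ 2 ≤
        ∑ i ∈ AbcClassI.cubeIdx (22 + 1) \ AbcClassI.cubeIdx 22,
          (((((Row3001C.lamRe : ℚ) : ℝ) : ℂ) + (((Row3001C.lamIm : ℚ) : ℝ) : ℂ) * Complex.I).re - (-(onormSq i.1 / 300)) - Real.sqrt 2) * ‖w i‖ ^ 2 -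
        RCLike.re (∑ i ∈ (AbcClassI.cubeIdx 22).biUnion AbcClassI.nbrIdx \ AbcClassI.cubeIdx 22,
          conj (∑ j : ↥(AbcClassI.cubeIdx 22), amc i j *
            (Binv (fun i : ↥(AbcClassI.cubeIdx 22) => ∑ j ∈ AbcClassI.nbrIdx i \ AbcClassI.cubeIdx 22,
              amc i j * w j, 0)).1 j) * w i))
    {HL HH HB : Finset AbcClassI.Idx}
    (hHL : ∀ i : AbcClassI.Idx, i ∈ HL ↔ onormSq i.1 ≤ (28 : ℝ) ^ 2)
    (hHH : ∀ i : AbcClassI.Idx, i ∈ HH ↔ onormSq i.1 ≤ (29 : ℝ) ^ 2)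
    (hHB : ∀ i : AbcClassI.Idx, i ∈ HB ↔ (29 : ℝ) ^ 2 < onormSq i.1 ∧ onormSq i.1 ≤ ((29 : ℝ) + 1) ^ 2)
    (GH Ah : Matrix ↥HH ↥HH ℝ) (AHB : Matrix ↥HH ↥HB ℝ) (ABH : Matrix ↥HB ↥HH ℝ) (E : ↥HB → ℝ)
    (V : Matrix ↥HH (Fin 2) ℝ) (hGH : GHᵀ = GH)
    (hAh : Ah = Matrix.of fun i j : ↥HH =>
      (if i = j then -(onormSq i.1.1 / (300 : ℝ)) - (43 / 200 : ℝ) else 0) + AbcClassI.amat i.1 j.1)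
    (hAHB : AHB = Matrix.of fun (i : ↥HH) (l : ↥HB) => AbcClassI.amat i.1 l.1)
    (hABH : ABH = Matrix.of fun (l : ↥HB) (i : ↥HH) => AbcClassI.amat l.1 i.1)
    (hE : E = fun l : ↥HB => onormSq l.1.1 / (300 : ℝ) + (43 / 200 : ℝ) - Real.sqrt 2)
    (hR1 : ∀ x : ↥HH → ℝ, x ≠ 0 →
      x ⬝ᵥ ((GH * Ah + Ahᵀ * GH + (1 / 2 : ℝ) • ((GH * AHB + ABHᵀ) * Matrix.diagonal (fun l => (E l)⁻¹) *
        (GH * AHB + ABHᵀ)ᵀ)) *ᵥ x) < 0)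
    (hR2 : ∀ x : ↥HH → ℝ, 0 ≤ x ⬝ᵥ ((GH + V * Vᵀ) *ᵥ x)) :
    ∃ lam : ℂ, ‖lam - ((((Row3001C.lamRe : ℚ) : ℝ) : ℂ) + (((Row3001C.lamIm : ℚ) : ℝ) : ℂ) * Complex.I)‖ ≤
        ((Row3001C.rho : ℚ) : ℝ) ∧ ((Row3001C.lamRe : ℚ) : ℝ) - ((Row3001C.rho : ℚ) : ℝ) ≤ lam.re ∧ 0 < lam.im ∧
      (∃ u : UnitAddTorus (Fin 3) → EuclideanSpace ℂ (Fin 3),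
        Torus.LinNSResolventRel (1 / (2 * Real.pi * 300)) (Torus.abcFlow 1 1 1) (2 * Real.pi * lam) u 0 ∧
          u ≠ 0 ∧ IsClassI (mFourierCoeff u)) ∧
      (∃ u : UnitAddTorus (Fin 3) → EuclideanSpace ℂ (Fin 3),
        Torus.LinNSResolventRel (1 / (2 * Real.pi * 300)) (Torus.abcFlow 1 1 1) (2 * Real.pi * conj lam) u 0 ∧
          u ≠ 0 ∧ IsClassI (mFourierCoeff u)) ∧
      ∀ (z : ℂ) (u : UnitAddTorus (Fin 3) → EuclideanSpace ℂ (Fin 3)),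
        Torus.LinNSResolventRel (1 / (2 * Real.pi * 300)) (Torus.abcFlow 1 1 1) (2 * Real.pi * z) u 0 → u ≠ 0 →
          IsClassI (mFourierCoeff u) → (43 / 200 : ℝ) ≤ z.re → z = lam ∨ z = conj lam := by
  obtain ⟨lam, hclose, hrelo, -, him, hpair, hpairc, -, -⟩ :=
    AbcClassIEigenpair.row3001C_classI_eigenpairs_of_complex_bases wf hws hwt hwI hwon amc hamc vt hvt0 hres hntb
      Binv hBinv hαM hβBM hβCM hgBM hshellM
  exact exactly_pair_of_row_of_cell (a := 43 / 200) a_le_row3001C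
    (fun z hz u hu hu0 hI hre => R300I_rL28_rH29_card_le_two hHL hHH hHB GH Ah AHB ABH E V hGH hAh hAHB hABH hE hR1 hR2
      z hz u hu hu0 hI hre)
    lam hclose hrelo him hpair hpairc

end Row

end Summit.NavierStokesRegularity.FluidComputer.AbcInertiaCI

end
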